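import Mathlib
import HarnessLib
import Summits.HubbardSuperconductivity.HubbardSuperconductivity.Theorems.KLProgrammeKLRegimeTwoVolumeLipDoubledDoorData
import Summits.HubbardSuperconductivity.HubbardSuperconductivity.Theorems.KLProgrammeKLRegimeTwoVolumeDoubledTowerStep
import Summits.HubbardSuperconductivity.HubbardSuperconductivity.Theorems.KLProgrammeKLRegimeTwoVolumeLipSourceSplit

/-!
# Route `KLProgramme` — crux K3 ENGINE (stmt-HubbardSuperconductivity-20437), stub (e) proof-input «(e)-D-ROWS», keying (A′), REKEY-D file D3:
# THE SOURCE OF THE DOUBLED BLOCK STEP — partition function of the doubled step, the glued coarse step as the copies step, the source defect as a covariance defect,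
# and THE DOUBLED COVARIANCE DEFECT IS THE SPECTATOR LIFT OF THE SECTOR DEFECT (seat hubbard-kl-k3c4-p1 g27; REKEY-D.md §2 «SRC door⁺»; doubled twin of ✓ `…TwoVolumeLipSourceSplit`)

The doubled born difference splits (D1 `klLipBornDiffD_eq_lip_add_src`) into the Lipschitz part (D2 `lipBlockStepD_deep_rate_le`) and the SOURCE
`map T⁺_{bL} (born⁺_{bL} G) − klGlueD (klLipBornD L)`, `G = klGlueD (klLipInputD L)`, `born⁺_V Y = effAction (klLipCovD V) Y − Y`, already in transfer form (D1 `klLipBornD_eq_map_step` at `L`: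
`klLipBornD L = map T⁺_L (born⁺_L (klLipInputD L))`).  This file supplies the two identities the transfer door
`…TwoVolumeSubstitutionGluingDeepPin.sum_norm_kernel_map_sub_glue_map_le_of_defect` consumes, on the doubled labels:

* §1 `effPartitionFn_klLipCovD_klLipInputD` (`Z(C ⊕ 0, klLipInputD) = Z(Γ_k, 𝒱_{dk})`, ✓ `effPartitionFn_spectatorCov_map_doubleRows_sector`), `isUnit_effPartitionFn_klLipCovD_klLipInputD`;
* §2 **`klGlueD_effAction`** (the glued coarse step is the copies step of the glued input, `Lit/….effAction_copies_sum` on `klBlockEquivD`), `isUnit_effPartitionFn_klCopiesCovD_klGlueD`,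
  **`lipSourceDefectD_eq`** (`born⁺_{bL} G − klGlueD (born⁺_L D_L) = effAction (klLipCovD bL) G − effAction (klCopiesCovD (klLipCovD L)) G`),
  `klCopiesCovD_klLipCovD_apply` and **`klLipDefectD_apply`** — `klLipDefectD X′ Y′ = [X′.2 = Y′.2 = 0]·klLipDefect X′.1 Y′.1`: the doubled covariance defect IS the spectator lift of
  the sector defect, so every near/far defect datum of the sector tower (✓ `…TwoVolumeLipDefectDefs`, F-D5b doors) is read verbatim through D2a's spectator-row lemmas.

Identities (plus unit lemmas); nothing asserts the (D) rows, (e), VL, K3 or superconductivity.  References: BGM 2006 §2.7 (2.70)–(2.71), §2.9 (4.3)–(4.6)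
[cite: BenfattoGiulianiMastropietro2006]; Salmhofer 1999 Def. 2.19 (2.102)–(2.106), App. B.2.
-/

noncomputable section

namespace Summit.HubbardSuperconductivity.HubbardSuperconductivity.Theorems.TwoVolumeLip

set_option linter.dupNamespace false -- summit = problem name (single-conjunct summit), D-0017

open Finset Literature.MathematicalPhysics.QuantumLattice GrassmannAlgebra Literature.Probability.LatticeModels
open Literature.MathematicalPhysics.QuantumLattice.FermiRG
open Summit.HubbardSuperconductivity.HubbardSuperconductivity.Theorems.KLRegimeSplit
open Summit.HubbardSuperconductivity.HubbardSuperconductivity.Theorems.KLProgrammeLegKernels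
open Summit.HubbardSuperconductivity.HubbardSuperconductivity.Theorems.EngineV8
open Summit.HubbardSuperconductivity.HubbardSuperconductivity.Theorems.TwoVolumeSource
open Summit.HubbardSuperconductivity.HubbardSuperconductivity.Theorems.TwoVolumeDefect

/-! ## D3 §1 One volume: the partition function of the doubled step -/

section PartD

variable {V M : ℕ} [NeZero V] [NeZero M]

/-- **The partition function of the spectator step of the doubled input IS the momentum-space block partition function**:
`Z(klLipCov ⊕ 0, klLipInputD … d k) = Z(Γ_k, 𝒱_{dk})` (`β ≠ 0`, `1 ≤ dk`). [cite: BenfattoGiulianiMastropietro2006, §2.9 (4.3)-(4.6)] -/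
theorem effPartitionFn_klLipCovD_klLipInputD {β : ℝ} (hβ : β ≠ 0) (U μ : ℝ) (K : TrigPolyC4v) {d k : ℕ} (hdk : 1 ≤ d * k) :
    effPartitionFn ℂ (klLipCovD V M β μ K d k) (klLipInputD V M β U μ K d k) =
      effPartitionFn ℂ (hubbardCovSliceCT V M β μ 0 K (klScale klE0 (d * (k + 1))) (klScale klE0 (d * k))) (klTowerInput V M β U μ K d k) := by
  have he : (0 : ℝ) < klE0 := by norm_num [klE0]
  have hJ : d * k ≤ d * (k + 1) := Nat.mul_le_mul_left d (Nat.le_succ k)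
  have hFF : ∀ ω p, bgmFatMultiplier V M klE0 β (nambuXiCT V μ K) (d * k - 1) ω p * klAnisoFamily V M β μ K klE0 (d * k - 1) ω p =
      klAnisoFamily V M β μ K klE0 (d * k - 1) ω p :=
    fun ω p => bgmFatMultiplier_mul_bgmMultiplier he β (nambuXiCT V μ K) (d * k - 1) ω p
  have hCpl : ∀ X Y, hubbardCovSliceCT V M β μ 0 K (klScale klE0 (d * (k + 1))) (klScale klE0 (d * k)) X Y ≠ 0 →
      ∑ ω, klAnisoFamily V M β μ K klE0 (d * k - 1) ω X.1.1 = 1 ∧ ∑ ω, klAnisoFamily V M β μ K klE0 (d * k - 1) ω Y.1.1 = 1 :=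
    fun X Y h => sum_klAnisoFamily_eq_one_of_blockSliceCT_ne_zero β μ K hdk hJ X Y h
  rw [klLipInputD_def]
  exact effPartitionFn_spectatorCov_map_doubleRows_sector hβ _ _ hFF _ hCpl (klLipCovD V M β μ K d k)
    (fun p q => by rw [klLipCovD_apply, klLipCov_def])
    ((((imagTimeWeight β M : ℝ) : ℂ)) • klPlainAnalysis V M β (sectorCount (d * k - 1))) _
    (smul_klSrcAnalysisAt_apply β μ K (d * k - 1)) (klTowerInput V M β U μ K d k)

/-- **… hence it is a unit** when `Z^K_{Λ_{dk}}, Z^K_{Λ_{d(k+1)}} ≠ 0` (slice multiplicativity `hubbardEffPartitionFnCT_eq_mul_slice`). -/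
theorem isUnit_effPartitionFn_klLipCovD_klLipInputD {β : ℝ} (hβ : β ≠ 0) (U μ : ℝ) (K : TrigPolyC4v) {d k : ℕ} (hdk : 1 ≤ d * k)
    (hZ : hubbardEffPartitionFnCT V M β U μ 0 K (klScale klE0 (d * k)) ≠ 0)
    (hZ' : hubbardEffPartitionFnCT V M β U μ 0 K (klScale klE0 (d * (k + 1))) ≠ 0) :
    IsUnit (effPartitionFn ℂ (klLipCovD V M β μ K d k) (klLipInputD V M β U μ K d k)) := by
  rw [effPartitionFn_klLipCovD_klLipInputD hβ U μ K hdk, isUnit_iff_ne_zero]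
  intro h0
  have hmul := hubbardEffPartitionFnCT_eq_mul_slice β U μ 0 K (klScale klE0 (d * (k + 1))) hZ
  unfold klTowerInput klEffectiveAction at h0
  rw [h0, mul_zero] at hmul
  exact hZ' hmul

end PartD

/-! ## D3 §2 Two volumes: the glued coarse doubled step is the copies step of the glued input; the source defect is the spectator lift of the sector defect -/

section SourceD

variable {L b M : ℕ} [NeZero L] [NeZero (b * L)] [NeZero M] {n : ℕ}

omit [NeZero M] in
/-- **The glued coarse step is the copies step of the glued input** (doubled labels): for `W` even without constant part and `Z(C′, W)` a unit,
`klGlueD (effAction C′ W) = effAction (klCopiesCovD C′) (klGlueD W)` (`Lit/GrassmannEffectiveActionCopies.effAction_copies_sum` on `klBlockEquivD`). -/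
theorem klGlueD_effAction (C' : Matrix (SrcLabel L M n) (SrcLabel L M n) ℂ) {W : GrassmannAlgebra ℂ (SrcLabel L M n)}
    (hWe : W ∈ evenOdd ℂ 0) (hW0 : constPart ℂ W = 0) (hZ : IsUnit (effPartitionFn ℂ C' W)) :
    klGlueD L b M n (effAction ℂ C' W) = effAction ℂ (klCopiesCovD L b M n C') (klGlueD L b M n W) := by
  classical
  have h := (effAction_copies_sum (klBlockEquivD L b M n) C' (klCopiesCovD L b M n C') (klCopiesCovD_apply C') (klBlockEmbD L b M n)
    klBlockEmbD_apply hWe hW0 hZ (univ : Finset (Fin 2 → Fin b))).2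
  rw [klGlueD_def, klGlueD_def, h]

omit [NeZero M] in
/-- The partition function of the glued input at the copies covariance is a unit (same data). -/
theorem isUnit_effPartitionFn_klCopiesCovD_klGlueD (C' : Matrix (SrcLabel L M n) (SrcLabel L M n) ℂ) {W : GrassmannAlgebra ℂ (SrcLabel L M n)}
    (hWe : W ∈ evenOdd ℂ 0) (hW0 : constPart ℂ W = 0) (hZ : IsUnit (effPartitionFn ℂ C' W)) :
    IsUnit (effPartitionFn ℂ (klCopiesCovD L b M n C') (klGlueD L b M n W)) := by
  classical
  have h := (effAction_copies_sum (klBlockEquivD L b M n) C' (klCopiesCovD L b M n C') (klCopiesCovD_apply C') (klBlockEmbD L b M n)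
    klBlockEmbD_apply hWe hW0 hZ (univ : Finset (Fin 2 → Fin b))).1
  rw [klGlueD_def]
  exact h

/-- **THE DEFECT OF THE DOUBLED SOURCE IS A COVARIANCE DEFECT AT THE GLUED INPUT**: with `G := klGlueD (klLipInputD L … d k)`, `born⁺_V Y := effAction (klLipCovD V) Y − Y`:
`born⁺_{bL} G − klGlueD (born⁺_L (klLipInputD L)) = effAction (klLipCovD (bL)) G − effAction (klCopiesCovD (klLipCovD L)) G` (coarse side: `β ≠ 0`, `1 ≤ dk`,
`Z^K_{L,Λ_{dk}}, Z^K_{L,Λ_{d(k+1)}} ≠ 0`) — the doubled twin of ✓ `lipSourceDefect_eq`. [cite: BenfattoGiulianiMastropietro2006, §2.7 (2.70)-(2.71)] -/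
theorem lipSourceDefectD_eq {β : ℝ} (hβ : β ≠ 0) (U μ : ℝ) (K : TrigPolyC4v) {d k : ℕ} (hdk : 1 ≤ d * k)
    (hZc : hubbardEffPartitionFnCT L M β U μ 0 K (klScale klE0 (d * k)) ≠ 0)
    (hZc' : hubbardEffPartitionFnCT L M β U μ 0 K (klScale klE0 (d * (k + 1))) ≠ 0) :
    (effAction ℂ (klLipCovD (b * L) M β μ K d k) (klGlueD L b M (d * k - 1) (klLipInputD L M β U μ K d k)) -
        klGlueD L b M (d * k - 1) (klLipInputD L M β U μ K d k)) -
      klGlueD L b M (d * k - 1) (effAction ℂ (klLipCovD L M β μ K d k) (klLipInputD L M β U μ K d k) - klLipInputD L M β U μ K d k) =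
      effAction ℂ (klLipCovD (b * L) M β μ K d k) (klGlueD L b M (d * k - 1) (klLipInputD L M β U μ K d k)) -
        effAction ℂ (klCopiesCovD L b M (d * k - 1) (klLipCovD L M β μ K d k)) (klGlueD L b M (d * k - 1) (klLipInputD L M β U μ K d k)) := by
  have hIc : klTowerInput L M β U μ K d k ∈ evenOdd ℂ 0 :=
    Summit.HubbardSuperconductivity.HubbardSuperconductivity.Theorems.KLRegimeWick.klEffectiveAction_mem_evenOdd_zero β U μ K klE0 (d * k)
  have hDe : klLipInputD L M β U μ K d k ∈ evenOdd ℂ 0 := klLipInputD_mem_evenOdd_zero hIc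
  have hD0 : constPart ℂ (klLipInputD L M β U μ K d k) = 0 := by
    rw [constPart_klLipInputD]; exact constPart_klEffectiveAction_eq_zero β U μ K klE0 (d * k) hZc
  have hZu := isUnit_effPartitionFn_klLipCovD_klLipInputD (V := L) hβ U μ K hdk hZc hZc'
  rw [klGlueD_sub, klGlueD_effAction _ hDe hD0 hZu]
  abel

omit [NeZero M] in
/-- **The copies of the spectator covariance are the spectator lift of the copies**: entrywise,
`klCopiesCovD (klLipCovD L … d k) X′ Y′ = [X′.2 = Y′.2 = 0] · klCopiesCov (klLipCov L … d k) X′.1 Y′.1`. -/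
theorem klCopiesCovD_klLipCovD_apply (β μ : ℝ) (K : TrigPolyC4v) (d k : ℕ) (X' Y' : SrcLabel (b * L) M (d * k - 1)) :
    klCopiesCovD L b M (d * k - 1) (klLipCovD L M β μ K d k) X' Y' =
      if X'.2 = 0 ∧ Y'.2 = 0 then klCopiesCov L b M (sectorCount (d * k - 1)) (klLipCov L M β μ K d k) X'.1 Y'.1 else 0 := by
  obtain ⟨x, s⟩ := X'
  obtain ⟨y, t⟩ := Y'
  rw [klCopiesCovD_apply, klCopiesCov_apply, klBlockEquivD_apply, klBlockEquivD_apply, klLipCovD_apply]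
  dsimp only
  split_ifs <;> rfl

omit [NeZero M] in
/-- **THE DOUBLED COVARIANCE DEFECT IS THE SPECTATOR LIFT OF THE SECTOR DEFECT**: `klLipDefectD … X′ Y′ = [X′.2 = Y′.2 = 0] · klLipDefect … X′.1 Y′.1` — hence every near/far row datum
of ✓ `…TwoVolumeLipDefectDefs` / the defect doors transfers verbatim (D2a `rowSum_/colSum_spectator_wt_le`). -/
theorem klLipDefectD_apply (β μ : ℝ) (K : TrigPolyC4v) (d k : ℕ) (X' Y' : SrcLabel (b * L) M (d * k - 1)) :
    klLipDefectD L b M β μ K d k X' Y' = if X'.2 = 0 ∧ Y'.2 = 0 then klLipDefect L b M β μ K d k X'.1 Y'.1 else 0 := by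
  rw [klLipDefectD_def, Matrix.sub_apply, klLipCovD_apply, klCopiesCovD_klLipCovD_apply, klLipDefect_def, Matrix.sub_apply]
  split_ifs <;> simp

end SourceD

end Summit.HubbardSuperconductivity.HubbardSuperconductivity.Theorems.TwoVolumeLip

end
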